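import Summits.QuantumFields.YangMills.Theorems.UnitScaleTiltProp7TopMeanAdjointBlockLocal
import HarnessLib

/-!
# Route `UnitScaleTilt`, crux K1 «MinimiserStabilityRegPr» (stmt-QuantumFields-19200), EX row `hGF[Lift]` (curved member) — **LOD LINE, PEN (L5″) (RN-near) BINDER `hXpT`:
# THE ADJOINT TOP MEAN OF A BLOCK-SUPPORTED COARSE SECTION IS FIXED BY A CUT-OFF EQUAL TO `1` ON THOSE BLOCKS** — discharges the plateau-fixing hypothesis
`hXpT : Xp (T_1 (ι d)) = T_1 (ι d)` of ✓`Prop7GramDifferenceNearRow.norm_gram_apply_sub_le_near` (px5 p757045): `T(ι d)` (the Hilbert adjoint of the lifted top mean of record applied to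
a coarse section `d`) vanishes at every fine site whose block carries `d = 0` (§1, from the single-block letter ✓`Prop7TopMeanAdjointBlockLocal.adjoint_apply_eq_zero_off_block` by
linearity over `d = Σ_Y δ_Y⊗d(Y)`), hence a site cut-off `χ` with `χ = 1` on the blocks of `supp d` fixes it (§2).  Any reading `ι` with disjoint-support orthogonality (the concrete
block-constant lift qualifies: ✓`inner_blockLift_eq_zero_of_disjoint`, §3).

Cell `ym3-torus` (HUMAN RULING D-0037, YM ladder rung R3 — NOT d = 4, NOT infinite volume, NOT a mass gap, NOT Clay).  Width seat `ym3-torus-px5` gen 11; ★p1 g24 LOCATE-L6-ASSEMBLY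
§1 Step I.2 (L5″), road (α).  THEOREMS ONLY (0 `def`, 0 `sorry`); `--supports stmt-QuantumFields-19200 --as helper`, count-neutral.  HONEST LABEL (★★OWNER RULING №33 (6)): curved
γ-row supplier line (LOD localisation), pen (L5″); support bookkeeping only; nothing of (3.49), Thm 3.1∕3.3, `h349`, `hGF`, EX ∕ 19200 is proved here.

References: T. Bałaban, CMP **99** (1985) 389–434 [Balaban1985BackgroundPropagators] ((3.19) p.393, (3.21)–(3.25) p.394); CMP **95** (1984) 17–40 [Balaban1984PropagatorsI] ((1.18) p.20).
-/

set_option autoImplicit false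

noncomputable section

open scoped BigOperators Matrix.Norms.L2Operator InnerProductSpace ComplexConjugate

namespace Summit.QuantumFields.YangMills.Theorems.Prop7AdjointTopMeanPlateauFixed

open Literature.MathematicalPhysics.QuantumFieldTheory.Balaban1983to89
open T4Continuum BlockAveraging
open BlockAveraging (Idx)
open B7Prop1Explicit (disp)
open B5Eq118OneStroke (iterBlockOf)
open B10Eq27TorusAxialLog (holT transl)
open B7TransferAnalyticMean (meanCLM)
open B11Eq103H1Complex (SiteL2K)
open Summit.QuantumFields.YangMills.Theorems.Prop8Chart (emlIterU)
open Literature.MathematicalPhysics.QuantumFieldTheory.Balaban1983to89.T3ContinuumYM3Torus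
open T3SectALandauChart (bgUnits)
open T3PrintedRegularOrbits (sites_eq)
open T3LevelShift (siteShift)
open Summit.QuantumFields.YangMills.Theorems.Prop7SectET3Transport (periodsT3)
open Summit.QuantumFields.YangMills.Theorems.Prop7SectET3HilbertLetters (W₂ toL2S)
open Summit.QuantumFields.YangMills.Theorems.Prop7TopMeanAdjointBlockLocal (adjoint_apply_eq_zero_off_block inner_blockLift_eq_zero_of_disjoint)

variable (F : T3Family) {n K : ℕ} {c₀ : ℝ} [Fact (0 < c₀)]
  (U₀ : GaugeField (F.P K) 0 (Matrix.specialUnitaryGroup (Fin 2) ℂ))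
  (Q'' : SiteL2K ℂ 3 (periodsT3 F K) c₀ W₂ →ₗ[ℂ] (Site (F.P K) (K - n) → Matrix (Fin 2) (Fin 2) ℂ))
  (hseq : ∀ lam : Site (F.P K) 0 → Matrix (Fin 2) (Fin 2) ℂ, ∃ ns : (j : ℕ) → Site (F.P K) j → Matrix (Fin 2) (Fin 2) ℂ, ns 0 = lam ∧
        (∀ (j : ℕ) (y : Site (F.P K) (j + 1)), ns (j + 1) y = ns j (emb y) - meanCLM (Idx (F.P K)) (Matrix (Fin 2) (Fin 2) ℂ) fun i : Idx (F.P K) =>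
          ns j (emb y) - ((holT (emlIterU j (bgUnits F K U₀)) (emb y) (stairWord i.2.1 (off i.1)) : (Matrix (Fin 2) (Fin 2) ℂ)ˣ) : Matrix (Fin 2) (Fin 2) ℂ) *
            ns j (transl (emb y) (disp (stairWord i.2.1 (off i.1)))) * (((holT (emlIterU j (bgUnits F K U₀)) (emb y) (stairWord i.2.1 (off i.1)))⁻¹ : (Matrix (Fin 2) (Fin 2) ℂ)ˣ) : Matrix (Fin 2) (Fin 2) ℂ)) ∧
        ns (K - n) = Q'' (toL2S F K c₀ lam))
  {Fc : Type*} [NormedAddCommGroup Fc] [InnerProductSpace ℂ Fc]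
  (ι : (Site (F.P K) (K - n) → Matrix (Fin 2) (Fin 2) ℂ) →ₗ[ℂ] Fc)
  (hι : ∀ c c' : Site (F.P K) (K - n) → Matrix (Fin 2) (Fin 2) ℂ, (∀ y, c y = 0 ∨ c' y = 0) → ⟪ι c, ι c'⟫_ℂ = 0)
  (T : Fc →ₗ[ℂ] SiteL2K ℂ 3 (periodsT3 F K) c₀ W₂)
  (hT : ∀ (l : SiteL2K ℂ 3 (periodsT3 F K) c₀ W₂) (f : Fc), ⟪ι (Q'' l), f⟫_ℂ = ⟪l, T f⟫_ℂ)

/-! ## §1 `T(ι d)` lives on the blocks of `supp d` -/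

include hseq hι hT in
/-- ★★ **THE ADJOINT TOP MEAN OF A COARSE SECTION VANISHES OFF THE BLOCKS OF ITS SUPPORT**: for every coarse `d` and every fine site `x` with `d (B^{K−n}(x)) = 0`,
`(toL2S⁻¹(T(ι d)))(x) = 0` (write `d = Σ_Y δ_Y⊗d(Y)`; each single-block piece vanishes at `x` by ✓`adjoint_apply_eq_zero_off_block`, the piece at `x`'s own block is `0`).
[cite: Balaban1985BackgroundPropagators, (3.21)-(3.25) p.394; Balaban1984PropagatorsI, (1.18) p.20] -/
theorem symm_adjoint_apply_eq_zero_off_support (d : Site (F.P K) (K - n) → Matrix (Fin 2) (Fin 2) ℂ) (x : Site (F.P K) 0) (hx : d (iterBlockOf (K - n) x) = 0) :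
    (toL2S F K c₀).symm (T (ι d)) x = 0 := by
  classical
  have hd : d = ∑ Y : Site (F.P K) (K - n), Pi.single Y (d Y) := by
    funext Y'
    rw [Finset.sum_apply, Finset.sum_eq_single Y' (fun Y _ hY => Pi.single_eq_of_ne' hY _) (fun hY => absurd (Finset.mem_univ Y') hY), Pi.single_eq_same]
  rw [hd, map_sum, map_sum, map_sum, Finset.sum_apply]
  refine Finset.sum_eq_zero fun Y _ => ?_
  by_cases hY : iterBlockOf (K - n) x = Y
  · subst hY
    rw [hx, Pi.single_zero, map_zero, map_zero, map_zero, Pi.zero_apply]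
  · exact adjoint_apply_eq_zero_off_block F U₀ Q'' hseq ι hι T hT (Pi.single Y (d Y)) Y (fun Y' hY' => Pi.single_eq_of_ne hY' _) x hY

/-! ## §2 A cut-off equal to `1` on those blocks fixes `T(ι d)` -/

include hseq hι hT in
/-- ★★★ **THE BINDER `hXpT`**: a cut-off `X` reading `χ·` on fields (`X(toL2S l) = toL2S(χ·l)`) with `χ = 1` on every block where `d ≠ 0` FIXES `T(ι d)`: `X (T (ι d)) = T (ι d)`.
[cite: Balaban1985BackgroundPropagators, (3.21)-(3.25) p.394] -/
theorem cutoff_adjoint_eq_self (X : SiteL2K ℂ 3 (periodsT3 F K) c₀ W₂ →ₗ[ℂ] SiteL2K ℂ 3 (periodsT3 F K) c₀ W₂) (χ : Site (F.P K) 0 → ℝ)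
    (hX : ∀ l : Site (F.P K) 0 → Matrix (Fin 2) (Fin 2) ℂ, X (toL2S F K c₀ l) = toL2S F K c₀ (fun x => χ x • l x))
    (d : Site (F.P K) (K - n) → Matrix (Fin 2) (Fin 2) ℂ) (hχ : ∀ x : Site (F.P K) 0, d (iterBlockOf (K - n) x) ≠ 0 → χ x = 1) :
    X (T (ι d)) = T (ι d) := by
  set l : Site (F.P K) 0 → Matrix (Fin 2) (Fin 2) ℂ := (toL2S F K c₀).symm (T (ι d)) with hl
  have hl' : toL2S F K c₀ l = T (ι d) := LinearEquiv.apply_symm_apply _ _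
  rw [← hl', hX]
  congr 1
  funext x
  by_cases hx : d (iterBlockOf (K - n) x) = 0
  · have : l x = 0 := symm_adjoint_apply_eq_zero_off_support F U₀ Q'' hseq ι hι T hT d x hx
    rw [this, smul_zero]
  · rw [hχ x hx, one_smul]

/-! ## §3 The concrete block-constant lift qualifies -/

/-- The lane's concrete reading `ι c = toL2S F n c₁ (c ∘ siteShift)` has the disjoint-support orthogonality used above (✓`inner_blockLift_eq_zero_of_disjoint`).
[cite: Balaban1985BackgroundPropagators, (3.16) p.393] -/
theorem blockLift_orthogonal (h : n ≤ K) {c₁ : ℝ} [Fact (0 < c₁)]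
    (ιc : (Site (F.P K) (K - n) → Matrix (Fin 2) (Fin 2) ℂ) →ₗ[ℂ] SiteL2K ℂ 3 (periodsT3 F n) c₁ W₂)
    (hιc : ∀ c, ιc c = toL2S F n c₁ (fun z => c (siteShift (sites_eq F n K h) z))) :
    ∀ c c' : Site (F.P K) (K - n) → Matrix (Fin 2) (Fin 2) ℂ, (∀ y, c y = 0 ∨ c' y = 0) → ⟪ιc c, ιc c'⟫_ℂ = 0 := by
  intro c c' hcc'
  rw [hιc, hιc]
  exact inner_blockLift_eq_zero_of_disjoint F h c c' hcc'

include hseq in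
/-- ★★★ **`hXpT` FOR THE CONCRETE LIFT**: with `ι c = toL2S F n c₁ (c ∘ siteShift)`, its Hilbert-adjoint letter `T` (`⟪ι(Q'' l), f⟫ = ⟪l, T f⟫`), a cut-off `X` reading `χ·` and
`χ = 1` on the blocks of `supp d`: `X (T (ι d)) = T (ι d)`. [cite: Balaban1985BackgroundPropagators, (3.16) p.393, (3.21)-(3.25) p.394] -/
theorem cutoff_adjoint_blockLift_eq_self (h : n ≤ K) {c₁ : ℝ} [Fact (0 < c₁)]
    (ιc : (Site (F.P K) (K - n) → Matrix (Fin 2) (Fin 2) ℂ) →ₗ[ℂ] SiteL2K ℂ 3 (periodsT3 F n) c₁ W₂)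
    (hιc : ∀ c, ιc c = toL2S F n c₁ (fun z => c (siteShift (sites_eq F n K h) z)))
    (Tc : SiteL2K ℂ 3 (periodsT3 F n) c₁ W₂ →ₗ[ℂ] SiteL2K ℂ 3 (periodsT3 F K) c₀ W₂) (hTc : ∀ (l : SiteL2K ℂ 3 (periodsT3 F K) c₀ W₂) (f : SiteL2K ℂ 3 (periodsT3 F n) c₁ W₂), ⟪ιc (Q'' l), f⟫_ℂ = ⟪l, Tc f⟫_ℂ)
    (X : SiteL2K ℂ 3 (periodsT3 F K) c₀ W₂ →ₗ[ℂ] SiteL2K ℂ 3 (periodsT3 F K) c₀ W₂) (χ : Site (F.P K) 0 → ℝ)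
    (hX : ∀ l : Site (F.P K) 0 → Matrix (Fin 2) (Fin 2) ℂ, X (toL2S F K c₀ l) = toL2S F K c₀ (fun x => χ x • l x))
    (d : Site (F.P K) (K - n) → Matrix (Fin 2) (Fin 2) ℂ) (hχ : ∀ x : Site (F.P K) 0, d (iterBlockOf (K - n) x) ≠ 0 → χ x = 1) :
    X (Tc (ιc d)) = Tc (ιc d) :=
  cutoff_adjoint_eq_self F U₀ Q'' hseq ιc (blockLift_orthogonal F h ιc hιc) Tc hTc X χ hX d hχ

end Summit.QuantumFields.YangMills.Theorems.Prop7AdjointTopMeanPlateauFixed
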